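import Mathlib

/-!
# `FiveTermCertificate` (route InverseLandau): the rational data of the certificate and their calculus

Support file for item `stmt-KontsevichZagierPeriods-13875` (`InverseLandau.FiveTermCertificate`):
Abel's five-term relation
`Li₂(x/(1−y)) + Li₂(y/(1−x)) − Li₂(x) − Li₂(y) − Li₂(xy/((1−x)(1−y))) = log(1−x) log(1−y)`
certified INSIDE the Kontsevich–Zagier calculus of moves, for real algebraic `0 < x`, `0 < y`,
`x + y < 1`, by a chain of Stokes elements on the closed unit cube `[0,1]³` (Ayoub's cubical
presentation, `KZCubicalCalculus.lean`; Stokes span calibration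
`SectorToKernel.stub_stokesSpanCalibration`). All data are RATIONAL functions with coefficients in
`ℚ(x, y)`, regular on the closed cube; they are written out in full in every statement (no
definitions are introduced). GLOSSARY of the informal names used in the docstrings of this and the
sibling files `…Facts/Tame/Loops.lean`, `InverseLandauFiveTermCertificate.lean`:

* `abelF(z₀,z₁) = x/((1−y) − xz₀z₁) + y/((1−x) − yz₀z₁) − x/(1 − xz₀z₁) − y/(1 − yz₀z₁)
  − xy/((1−x)(1−y) − xyz₀z₁) − x/(1−xz₀)·y/(1−yz₁)` — the five-term integrand (`∫_{(0,1)²}` of the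
  `k`-th term is `±Li₂(aₖ)`, of the last `log(1−x)log(1−y)`);
* the TATE HOMOTOPY `tatePhi(z₀,z₁,w)` = `abelF` with `x ↦ xw`, every term in the shape
  `αw/(β − γw)` or `α/(β − γw)` (`tatePhi|_{w=1} = abelF`, `tatePhi|_{w=0} = 0`);
* the WEIGHT DROP `∂_w tatePhi = tateBz + tateAz = ∂_{z₁}tateB + ∂_{z₀}tateA` with the rational
  primitives `tateB = Σ ±α z₁/(β − γz₀z₁)` (`∫₀¹ dz₁/(β − γz₀z₁)² = 1/(β(β − γz₀))` is rational) and
  `tateA = −x z₀/(1 − xwz₀)·y/(1 − yz₁)`; the weight-one remainders `gOne(t,w) = tateB(t,1,w)`,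
  `gTwo(t,w) = tateA(1,t,w)`;
* the LOOP LETTER BLOCKS `mOne(t,w) = xwy·t(t−1)/((1−xw)(1−y−xwt))`,
  `mTwo(t,w) = xwy·t(t−1)/((1−y)(1−xw−yt))` with `t`-derivatives `mOneT`, `mTwoT` (quotient rule,
  uncancelled): the two loops `φ₁ = 1 + xw·mOne`, `φ₂ = 1 + y·mTwo` satisfy `φ_q(0,w) = φ_q(1,w) = 1`
  and `gOne + gTwo = x ∂ₜlog φ₁ + (xy/(1−xw)) ∂ₜlog φ₂` (`gOne_add_gTwo`, the differentiated Abel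
  identity regrouped by the Landau letters `1−xwt, 1−y−xwt, 1−xw−yt, (1−xw)(1−y)−xwyt, 1−yt`);
* the LOOP CERTIFICATE (`DlogLoopRelator` pattern of the route, parameter `w` carried along):
  `Ψ = 1 + uσm` (`= (1−u)·1 + u·φ`), `loopG(κ,σ,m,m',u) = uκm'/(1+uσm) = κΨₜ/Ψ`,
  `loopH(κ,σ,m,u) = κm/(1+uσm) = κσ⁻¹Ψᵤ/Ψ`, `loopK = κm'/(1+uσm)² = ∂ᵤloopG = ∂ₜloopH`.

This file: the one-variable derivatives (quotient rule) and the polynomial identities between these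
functions, and the agreement of the item's nested-fraction integrand with `abelF`
(`route_integrand_eq_abelF`).

References: D. Zagier, *The dilogarithm function* (2007), Ch. I §2 (the five-term relation and its
proof by differentiation); M. Kontsevich, D. Zagier, *Periods* (2001), §1.2; J. Ayoub, *Periods and
the conjectures of Grothendieck and Kontsevich–Zagier* (2014), Def. 10.
-/

noncomputable section

namespace Summit.KontsevichZagierPeriods.InverseLandau.FiveTerm

open Set

/-! ## One-variable derivatives (quotient rule) -/

/-- `d/ds [α s/(β − γ s)] = α β/(β − γ s)²`. [folklore] -/
theorem hasDerivAt_mul_div (α β γ s : ℝ) (h : β - γ * s ≠ 0) :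
    HasDerivAt (fun s : ℝ => α * s / (β - γ * s)) (α * β / (β - γ * s) ^ 2) s := by
  have hn : HasDerivAt (fun s : ℝ => α * s) (α * 1) s := (hasDerivAt_id' s).const_mul α
  have hd : HasDerivAt (fun s : ℝ => β - γ * s) (-(γ * 1)) s :=
    ((hasDerivAt_id' s).const_mul γ).const_sub β
  refine (hn.div hd h).congr_deriv ?_
  ring

/-- `d/ds [α s/(1 − γ s)] = α/(1 − γ s)²`. [folklore] -/
theorem hasDerivAt_mul_div_one (α γ s : ℝ) (h : 1 - γ * s ≠ 0) :
    HasDerivAt (fun s : ℝ => α * s / (1 - γ * s)) (α / (1 - γ * s) ^ 2) s := by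
  refine (hasDerivAt_mul_div α 1 γ s h).congr_deriv ?_
  ring

/-- `d/ds [α/(β − γ s)] = α γ/(β − γ s)²`. [folklore] -/
theorem hasDerivAt_const_div (α β γ s : ℝ) (h : β - γ * s ≠ 0) :
    HasDerivAt (fun s : ℝ => α / (β - γ * s)) (α * γ / (β - γ * s) ^ 2) s := by
  have hd : HasDerivAt (fun s : ℝ => β - γ * s) (-(γ * 1)) s :=
    ((hasDerivAt_id' s).const_mul γ).const_sub β
  refine ((hasDerivAt_const s α).div hd h).congr_deriv ?_
  ring

/-- **Weight drop.** `∂_w tatePhi = tateBz + tateAz` (termwise: `∂_w` of `α w/(β − γ w)` is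
`αβ/(β − γw)²`, and the same rational function is `∂_{z₁}` resp. `∂_{z₀}` of the corresponding term
of `tateB`, `tateA`). [Zagier 2007, Ch. I §2 (differentiate in `x`)] -/
theorem hasDerivAt_tatePhi (x y z0 z1 w : ℝ) (h3 : (1 - y) - (x * z0 * z1) * w ≠ 0)
    (h4 : (1 - y * z0 * z1) - x * w ≠ 0) (h1 : 1 - (x * z0 * z1) * w ≠ 0)
    (h5 : (1 - y) - (x * (1 - y) + x * y * z0 * z1) * w ≠ 0) (h6 : 1 - (x * z0) * w ≠ 0) :
    HasDerivAt (fun s : ℝ => (x * s / ((1 - y) - (x * z0 * z1) * s) + y / ((1 - y * z0 * z1) - x * s) - x * s / (1 - (x * z0 * z1) * s) - y / (1 - y * z0 * z1) - (x * y) * s / ((1 - y) - (x * (1 - y) + x * y * z0 * z1) * s) - x * s / (1 - (x * z0) * s) * (y / (1 - y * z1)))) ((x * (1 - y) / ((1 - y) - (x * w * z0) * z1) ^ 2 + x * y / ((1 - x * w) - (y * z0) * z1) ^ 2 - x / (1 - (x * w * z0) * z1) ^ 2 - x * y * (1 - y) / ((1 - x * w) * (1 - y) - (x * w * y * z0) *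 z1) ^ 2) + (-(x / (1 - (x * w) * z0) ^ 2 * (y / (1 - y * z1))))) w := by
  have t3 := hasDerivAt_mul_div x (1 - y) (x * z0 * z1) w h3
  have t4 := hasDerivAt_const_div y (1 - y * z0 * z1) x w h4
  have t1 := hasDerivAt_mul_div_one x (x * z0 * z1) w h1
  have t2 := hasDerivAt_const w (y / (1 - y * z0 * z1))
  have t5 := hasDerivAt_mul_div (x * y) (1 - y) (x * (1 - y) + x * y * z0 * z1) w h5
  have t6 := (hasDerivAt_mul_div_one x (x * z0) w h6).mul_const (y / (1 - y * z1))
  refine (((((t3.add t4).sub t1).sub t2).sub t5).sub t6).congr_deriv ?_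
  ring

/-- `∂_{z₁} tateB = tateBz`. [folklore] -/
theorem hasDerivAt_tateB (x y z0 z1 w : ℝ) (hX : 1 - x * w ≠ 0)
    (h3 : (1 - y) - (x * w * z0) * z1 ≠ 0) (h4 : (1 - x * w) - (y * z0) * z1 ≠ 0)
    (h1 : 1 - (x * w * z0) * z1 ≠ 0) (h5 : (1 - x * w) * (1 - y) - (x * w * y * z0) * z1 ≠ 0) :
    HasDerivAt (fun s : ℝ => (x * s / ((1 - y) - (x * w * z0) * s) + (x * y / (1 - x * w)) * s / ((1 - x * w) - (y * z0) * s) - x * s / (1 - (x * w * z0) * s) - (x * y / (1 - x * w)) * s / ((1 - x * w) * (1 - y) - (x * w * y * z0) * s))) ((x * (1 - y) / ((1 - y) - (x * w * z0) * z1) ^ 2 + x * y / ((1 - x * w) - (y * z0) * z1) ^ 2 - x / (1 - (x * w * z0) * z1) ^ 2 - x * y * (1 - y) / ((1 - x * w) * (1 - y) - (x * w * y * z0) * z1) ^ 2)) z1 := by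
  have t3 := hasDerivAt_mul_div x (1 - y) (x * w * z0) z1 h3
  have t4 := hasDerivAt_mul_div (x * y / (1 - x * w)) (1 - x * w) (y * z0) z1 h4
  have t1 := hasDerivAt_mul_div_one x (x * w * z0) z1 h1
  have t5 := hasDerivAt_mul_div (x * y / (1 - x * w)) ((1 - x * w) * (1 - y)) (x * w * y * z0) z1 h5
  have c4 : x * y / (1 - x * w) * (1 - x * w) = x * y := div_mul_cancel₀ _ hX
  have c5 : x * y / (1 - x * w) * ((1 - x * w) * (1 - y)) = x * y * (1 - y) := by
    rw [← mul_assoc, div_mul_cancel₀ _ hX]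
  refine (((t3.add t4).sub t1).sub t5).congr_deriv ?_
  rw [c4, c5]

/-- `∂_{z₀} tateA = tateAz`. [folklore] -/
theorem hasDerivAt_tateA (x y z0 z1 w : ℝ) (h6 : 1 - (x * w) * z0 ≠ 0) :
    HasDerivAt (fun s : ℝ => (-(x * s / (1 - (x * w) * s) * (y / (1 - y * z1))))) ((-(x / (1 - (x * w) * z0) ^ 2 * (y / (1 - y * z1))))) z0 := by
  have t6 := ((hasDerivAt_mul_div_one x (x * w) z0 h6).mul_const (y / (1 - y * z1))).neg
  refine t6.congr_deriv ?_
  ring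

/-- `∂ₜ mOne = mOneT`. [folklore] -/
theorem hasDerivAt_mOne (x y t w : ℝ) (h : (1 - x * w) * ((1 - y) - x * w * t) ≠ 0) :
    HasDerivAt (fun s : ℝ => ((x * w * y) * (s * (s - 1)) / ((1 - x * w) * ((1 - y) - x * w * s)))) ((((x * w * y) * (t + t - 1) * ((1 - x * w) * ((1 - y) - x * w * t)) - (x * w * y) * (t * (t - 1)) * ((1 - x * w) * (-(x * w)))) / ((1 - x * w) * ((1 - y) - x * w * t)) ^ 2)) t := by
  have hn : HasDerivAt (fun s : ℝ => (x * w * y) * (s * (s - 1)))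
      ((x * w * y) * (1 * (t - 1) + t * 1)) t :=
    ((hasDerivAt_id' t).mul ((hasDerivAt_id' t).sub_const 1)).const_mul _
  have hd : HasDerivAt (fun s : ℝ => (1 - x * w) * ((1 - y) - x * w * s))
      ((1 - x * w) * (-(x * w * 1))) t :=
    (((hasDerivAt_id' t).const_mul (x * w)).const_sub (1 - y)).const_mul _
  refine (hn.div hd h).congr_deriv ?_
  ring

/-- `∂ₜ mTwo = mTwoT`. [folklore] -/
theorem hasDerivAt_mTwo (x y t w : ℝ) (h : (1 - y) * ((1 - x * w) - y * t) ≠ 0) :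
    HasDerivAt (fun s : ℝ => ((x * w * y) * (s * (s - 1)) / ((1 - y) * ((1 - x * w) - y * s)))) ((((x * w * y) * (t + t - 1) * ((1 - y) * ((1 - x * w) - y * t)) - (x * w * y) * (t * (t - 1)) * ((1 - y) * (-y))) / ((1 - y) * ((1 - x * w) - y * t)) ^ 2)) t := by
  have hn : HasDerivAt (fun s : ℝ => (x * w * y) * (s * (s - 1)))
      ((x * w * y) * (1 * (t - 1) + t * 1)) t :=
    ((hasDerivAt_id' t).mul ((hasDerivAt_id' t).sub_const 1)).const_mul _
  have hd : HasDerivAt (fun s : ℝ => (1 - y) * ((1 - x * w) - y * s)) ((1 - y) * (-(y * 1))) t :=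
    (((hasDerivAt_id' t).const_mul y).const_sub (1 - x * w)).const_mul _
  refine (hn.div hd h).congr_deriv ?_
  ring

/-- `∂ᵤ loopG = loopK` (a Möbius function of `u`). [folklore] -/
theorem hasDerivAt_loopG (κ σ m m' u : ℝ) (h : 1 + u * σ * m ≠ 0) :
    HasDerivAt (fun s : ℝ => (s * κ * m' / (1 + s * σ * m))) ((κ * m' / (1 + u * σ * m) ^ 2)) u := by
  have hn : HasDerivAt (fun s : ℝ => s * κ * m') (1 * κ * m') u :=
    ((hasDerivAt_id' u).mul_const κ).mul_const m'
  have hd : HasDerivAt (fun s : ℝ => 1 + s * σ * m) (1 * σ * m) u :=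
    (((hasDerivAt_id' u).mul_const σ).mul_const m).const_add 1
  refine (hn.div hd h).congr_deriv ?_
  ring

/-- `∂ₜ loopH = loopK` along a differentiable letter block `M` with `∂ₜ M = M'`. [folklore] -/
theorem hasDerivAt_loopH {M : ℝ → ℝ} {M' t : ℝ} (κ σ u : ℝ) (hM : HasDerivAt M M' t)
    (h : 1 + u * σ * M t ≠ 0) :
    HasDerivAt (fun s : ℝ => (κ * (M s) / (1 + u * σ * (M s)))) ((κ * M' / (1 + u * σ * (M t)) ^ 2)) t := by
  have hn : HasDerivAt (fun s : ℝ => κ * M s) (κ * M') t := hM.const_mul κ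
  have hd : HasDerivAt (fun s : ℝ => 1 + u * σ * M s) (u * σ * M') t :=
    (hM.const_mul (u * σ)).const_add 1
  refine (hn.div hd h).congr_deriv ?_
  ring

/-! ## Polynomial identities -/

/-- The five-term integrand of the item (nested fractions `a/(1 − a z₀ z₁)`, `a` the five Abel
arguments) equals the cleared form `abelF` wherever the denominators are non-zero. [folklore] -/
theorem route_integrand_eq_abelF (x y z0 z1 : ℝ) (hx : 1 - x ≠ 0) (hy : 1 - y ≠ 0)
    (h3 : (1 - y) - x * z0 * z1 ≠ 0) (h4 : (1 - x) - y * z0 * z1 ≠ 0)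
    (h5 : (1 - x) * (1 - y) - x * y * z0 * z1 ≠ 0) :
    (x / (1 - y)) / (1 - (x / (1 - y)) * z0 * z1) + (y / (1 - x)) / (1 - (y / (1 - x)) * z0 * z1)
      - x / (1 - x * z0 * z1) - y / (1 - y * z0 * z1)
      - (x * y / ((1 - x) * (1 - y))) / (1 - (x * y / ((1 - x) * (1 - y))) * z0 * z1)
      - (x / (1 - x * z0)) * (y / (1 - y * z1)) = (x / ((1 - y) - x * z0 * z1) + y / ((1 - x) - y * z0 * z1) - x / (1 - x * z0 * z1) - y / (1 - y * z0 * z1) - x * y / ((1 - x) * (1 - y) - x * y * z0 * z1) - x / (1 - x * z0) * (y / (1 - y * z1))) := by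
  have e1 : 1 - (x / (1 - y)) * z0 * z1 = ((1 - y) - x * z0 * z1) / (1 - y) := by field_simp
  have e2 : 1 - (y / (1 - x)) * z0 * z1 = ((1 - x) - y * z0 * z1) / (1 - x) := by field_simp
  have e3 : 1 - (x * y / ((1 - x) * (1 - y))) * z0 * z1 =
      ((1 - x) * (1 - y) - x * y * z0 * z1) / ((1 - x) * (1 - y)) := by
    field_simp
  have f1 : (x / (1 - y)) / (((1 - y) - x * z0 * z1) / (1 - y)) = x / ((1 - y) - x * z0 * z1) := by
    rw [div_div_div_cancel_right₀ hy]
  have f2 : (y / (1 - x)) / (((1 - x) - y * z0 * z1) / (1 - x)) = y / ((1 - x) - y * z0 * z1) := by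
    rw [div_div_div_cancel_right₀ hx]
  have f3 : (x * y / ((1 - x) * (1 - y))) / (((1 - x) * (1 - y) - x * y * z0 * z1) / ((1 - x) * (1 - y)))
      = x * y / ((1 - x) * (1 - y) - x * y * z0 * z1) := by
    rw [div_div_div_cancel_right₀ (mul_ne_zero hx hy)]
  rw [e1, e2, e3, f1, f2, f3]

/-- Closing the first loop: `1 + xw · mOne = φ₁ = (1 − xwt)·((1−xw)(1−y) − xwyt)/((1−xw)(1−y−xwt))`.
[folklore] -/
theorem one_add_mul_mOne (x y t w : ℝ) (hX : 1 - x * w ≠ 0) (h2 : (1 - y) - x * w * t ≠ 0) :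
    1 + x * w * ((x * w * y) * (t * (t - 1)) / ((1 - x * w) * ((1 - y) - x * w * t))) =
      (1 - x * w * t) * ((1 - x * w) * (1 - y) - x * w * y * t) / ((1 - x * w) * ((1 - y) - x * w * t)) := by
  field_simp
  ring

/-- Closing the second loop: `1 + y · mTwo = φ₂ = (1 − yt)·((1−xw)(1−y) − xwyt)/((1−y)(1−xw−yt))`.
[folklore] -/
theorem one_add_mul_mTwo (x y t w : ℝ) (hY : 1 - y ≠ 0) (h3 : (1 - x * w) - y * t ≠ 0) :
    1 + y * ((x * w * y) * (t * (t - 1)) / ((1 - y) * ((1 - x * w) - y * t))) =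
      (1 - y * t) * ((1 - x * w) * (1 - y) - x * w * y * t) / ((1 - y) * ((1 - x * w) - y * t)) := by
  field_simp
  ring

/-- The first loop integrand in partial fractions:
`x · ∂ₜ log φ₁ = x (−1/(1 − xwt) − y/((1−xw)(1−y) − xwyt) + 1/(1 − y − xwt))`. [folklore] -/
theorem loop_one_value (x y t w : ℝ) (hX : 1 - x * w ≠ 0) (h2 : (1 - y) - x * w * t ≠ 0)
    (h5 : 1 - x * w * t ≠ 0) (hD : (1 - x * w) * (1 - y) - x * w * y * t ≠ 0) :
    x * (((x * w * y) * (t + t - 1) * ((1 - x * w) * ((1 - y) - x * w * t)) - (x * w * y) * (t * (t - 1)) * ((1 - x * w) * (-(x * w)))) / ((1 - x * w) * ((1 - y) - x * w * t)) ^ 2) / (1 + x * w * ((x * w * y) * (t * (t - 1)) / ((1 - x * w) * ((1 - y) - x * w * t)))) =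
      x * (-1 / (1 - x * w * t) - y / ((1 - x * w) * (1 - y) - x * w * y * t)
        + 1 / ((1 - y) - x * w * t)) := by
  rw [one_add_mul_mOne x y t w hX h2]
  set D := (1 - x * w) * (1 - y) - x * w * y * t with hDdef
  field_simp
  rw [hDdef]
  ring

/-- The second loop integrand in partial fractions:
`(xy/(1−xw)) · ∂ₜ log φ₂ = (xy/(1−xw)) (−1/(1 − yt) − xw/((1−xw)(1−y) − xwyt) + 1/(1 − xw − yt))`.
[folklore] -/
theorem loop_two_value (x y t w : ℝ) (hX : 1 - x * w ≠ 0) (hY : 1 - y ≠ 0)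
    (h3 : (1 - x * w) - y * t ≠ 0) (h6 : 1 - y * t ≠ 0)
    (hD : (1 - x * w) * (1 - y) - x * w * y * t ≠ 0) :
    (x * y / (1 - x * w)) * (((x * w * y) * (t + t - 1) * ((1 - y) * ((1 - x * w) - y * t)) - (x * w * y) * (t * (t - 1)) * ((1 - y) * (-y))) / ((1 - y) * ((1 - x * w) - y * t)) ^ 2) / (1 + y * ((x * w * y) * (t * (t - 1)) / ((1 - y) * ((1 - x * w) - y * t)))) =
      (x * y / (1 - x * w)) * (-1 / (1 - y * t) - x * w / ((1 - x * w) * (1 - y) - x * w * y * t)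
        + 1 / ((1 - x * w) - y * t)) := by
  rw [one_add_mul_mTwo x y t w hY h3]
  set D := (1 - x * w) * (1 - y) - x * w * y * t with hDdef
  field_simp
  rw [hDdef]
  ring

/-- **The differentiated Abel identity as a sum of two loops**:
`gOne + gTwo = x ∂ₜ log φ₁ + (xy/(1−xw)) ∂ₜ log φ₂` — the logarithms of the Landau letters
`1 − xwt, 1 − y − xwt, 1 − xw − yt, (1−xw)(1−y) − xwyt, 1 − yt` regroup into the two loops
`φ₁`, `φ₂` with `φ_q(0,w) = φ_q(1,w) = 1`. [Zagier 2007, Ch. I §2] -/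
theorem gOne_add_gTwo (x y t w : ℝ) (hX : 1 - x * w ≠ 0) (hY : 1 - y ≠ 0)
    (h2 : (1 - y) - x * w * t ≠ 0) (h3 : (1 - x * w) - y * t ≠ 0) (h5 : 1 - x * w * t ≠ 0)
    (h6 : 1 - y * t ≠ 0) (hD : (1 - x * w) * (1 - y) - x * w * y * t ≠ 0) :
    ((x * 1 / ((1 - y) - (x * w * t) * 1) + (x * y / (1 - x * w)) * 1 / ((1 - x * w) - (y * t) * 1) - x * 1 / (1 - (x * w * t) * 1) - (x * y / (1 - x * w)) * 1 / ((1 - x * w) * (1 - y) - (x * w * y * t) * 1))) + ((-(x * 1 / (1 - (x * w) * 1) * (y / (1 - y * t))))) =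
      x * (((x * w * y) * (t + t - 1) * ((1 - x * w) * ((1 - y) - x * w * t)) - (x * w * y) * (t * (t - 1)) * ((1 - x * w) * (-(x * w)))) / ((1 - x * w) * ((1 - y) - x * w * t)) ^ 2) / (1 + x * w * ((x * w * y) * (t * (t - 1)) / ((1 - x * w) * ((1 - y) - x * w * t))))
        + (x * y / (1 - x * w)) * (((x * w * y) * (t + t - 1) * ((1 - y) * ((1 - x * w) - y * t)) - (x * w * y) * (t * (t - 1)) * ((1 - y) * (-y))) / ((1 - y) * ((1 - x * w) - y * t)) ^ 2) / (1 + y * ((x * w * y) * (t * (t - 1)) / ((1 - y) * ((1 - x * w) - y * t)))) := by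
  rw [loop_one_value x y t w hX h2 h5 hD, loop_two_value x y t w hX hY h3 h6 hD]
  simp only [mul_one]
  set D := (1 - x * w) * (1 - y) - x * w * y * t with hDdef
  field_simp
  rw [hDdef]
  ring

end Summit.KontsevichZagierPeriods.InverseLandau.FiveTerm
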